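import Summits.ValiantsHypothesis.ValiantsHypothesis.Theorems.LacunarySymmetroidMatrixDescartesNsdPivotLoneTiltedDesign

/-!
# `MatrixDescartes` (stmt-ValiantsHypothesis-18050) — BOTH `(1 | K−1)` NSD ROWS ARE EXACT FOR EVERY `K ≥ 1`:
# rank-one lone letter `= 2K − 1` (the END LAW is sharp), free lone letter `= 2K` (the NSD `2K` law is sharp); `K = 5`: `9` and `10`

HONEST FRAMING.  Cell `pub-symmetroid`, seat `val-sym-mdr-p2` (gen 29); helper file `--supports` the crux
`Theses.LacunarySymmetroid.MatrixDescartes` (OPEN), NO closure claim.  BOOKKEEPING over the companion `…NsdPivotLoneTiltedDesign` (the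
tilted cluster: `exists_tilted_rankOne_design (G)` with `2G + 5` roots, `exists_tilted_fullRank_design (G)` with `2G + 6` roots, at
`K = G + 3`) in the row format of gens 27–28 (`∀ e d J P k₀, (−J).PosSemidef → (∀ k, (P k).PosSemidef) → d k₀ < e → (∀ k ≠ k₀, e < d k)
→ [(P k₀).det = 0 →] pivotPosRoots e d J P ≤ B`; GENUINE = with `Function.Injective d` and `P k ≠ 0`):
* §2 RANK-ONE LONE LETTER, every `K ≥ 3`: valid `B` ⟺ `2K − 1 ≤ B` (`loneBelow_rankOne_iff`, genuine `loneBelow_rankOne_genuine_iff`;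
  ⇐ is gen 27's END LAW `NsdLoneRankOne.pivotPosRoots_succ_le_of_lone_below`), and a genuine pencil with EXACTLY `2K − 1` roots exists
  (`exists_loneBelow_rankOne_eq`).  THE ROW IS `2K − 1`; the located ladder `5, 7, ≥ 7` (gens 11/27/28) becomes `5, 7, 9, 11, …`.
* §3 FREE LONE LETTER, every `K ≥ 3`: valid `B` ⟺ `2K ≤ B` (`loneBelow_iff`, `loneBelow_genuine_iff`; ⇐ is the NSD `2K` law), and a
  genuine pencil with a FULL-RANK lone letter and EXACTLY `2K` roots exists (`exists_loneBelow_eq`).  THE ROW IS `2K`.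
* §4 `K = 5`: `loneBelow_rankOne_five_iff (B) : valid₅ B ↔ 9 ≤ B` (the question of record «7 or 9?» of gens 27–28: NINE) and
  `loneBelow_five_iff (B) : … ↔ 10 ≤ B`.
So the END LAW «a singular lone letter costs exactly one root» holds with EQUALITY on `(1 | K−1)` for every `K ≥ 3` (it was known at
`K = 3, 4`), and the brackets `[7, 2K − 1]` / `[8, 2K]` of `NsdLoneLadder` (gen 28) and `{2K − 2, 2K − 1}` / `{2K − 1, 2K}` of
`NsdLoneParallelRows` (this seat, #2) close.  `K ≤ 2` is not covered by the tilt (it needs two upper letters): §5 gives the small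
explicit certificates (`small_one`: `K = 1`, `1` resp. `2` roots; `small_two`: `K = 2`, lone rank-one + ONE full-rank upper letter
`diag(100, 1/1000) t²`, `3` resp. `4` roots) and the rows for EVERY `K ≥ 1`: **`loneBelow_rankOne_iff_allK (hK : 1 ≤ K) (B) :
valid_K B ↔ 2K − 1 ≤ B`** and **`loneBelow_iff_allK (hK : 1 ≤ K) (B) : valid′_K B ↔ 2K ≤ B`**, whence the whole `2 × 2`
NSD-pivot row (any supports, any ranks) is EXACTLY `2K` for every `K ≥ 1` (`nsd_two_iff_allK`; gen 11's question).  Nothing here bears on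
`MatrixDescartes` in its window, on `DoorA26` / `DoorA34`, on the cell's registers beyond these sub-rows, or on `VP ≠ VNP`.

[folklore] Bookkeeping over the companion files and the cited tree ceilings; the objects are this seat's (gen 29).
-/

set_option linter.dupNamespace false

namespace Summit.ValiantsHypothesis.ValiantsHypothesis.Theorems.LacunarySymmetroidMatrixDescartes.Pivot.NsdLoneTiltedRows

open Polynomial Matrix Finset NsdLoneParallelDesign NsdLoneParallelRows NsdLoneTiltedDesign
open scoped BigOperators

/-! ## 1. Class membership of the tilted designs -/

/-- The letters of the tilted design are positive semidefinite (`c ≥ 1`, `a > 0`, `At k > 0`; the tilted letter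
`a·(ε,1)(ε,1)ᵀ` has `det = 0`). [folklore] -/
theorem tilted_letters_posSemidef {G : ℕ} {a ε c : ℝ} {At : Fin (G + 1) → ℝ} (ha : 0 < a) (hAt : ∀ k, 0 < At k)
    (hc : 1 ≤ c) :
    ∀ k, ((Fin.cons (!![(1 : ℝ), 1; 1, c]) (Fin.cons (!![a * ε ^ 2, a * ε; a * ε, a]) (fun k => !![(0 : ℝ), 0; 0, At k]))
      : Fin (G + 1 + 1 + 1) → Matrix (Fin 2) (Fin 2) ℝ) k).PosSemidef := by
  intro k
  cases k using Fin.cases with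
  | zero => simpa using PivotTwoFourWitness.posSemidef_two_of_entries 1 1 c (by norm_num) (by linarith) (by linarith)
  | succ k' =>
    cases k' using Fin.cases with
    | zero =>
      simpa using PivotTwoFourWitness.posSemidef_two_of_entries (a * ε ^ 2) (a * ε) a (by positivity) ha.le
        (le_of_eq (by ring))
    | succ k'' => simpa using PivotTwoFourWitness.posSemidef_two_of_entries 0 0 (At k'') le_rfl (hAt k'').le (by simp)

/-- The letters of the tilted design are non-zero. [folklore] -/
theorem tilted_letters_ne_zero {G : ℕ} {a ε : ℝ} (c : ℝ) {At : Fin (G + 1) → ℝ} (ha : 0 < a) (hAt : ∀ k, 0 < At k) :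
    ∀ k, ((Fin.cons (!![(1 : ℝ), 1; 1, c]) (Fin.cons (!![a * ε ^ 2, a * ε; a * ε, a]) (fun k => !![(0 : ℝ), 0; 0, At k]))
      : Fin (G + 1 + 1 + 1) → Matrix (Fin 2) (Fin 2) ℝ) k) ≠ 0 := by
  intro k
  cases k using Fin.cases with
  | zero => simp only [Fin.cons_zero]; intro h; have := congrFun (congrFun h 0) 0; simp at this
  | succ k' =>
    cases k' using Fin.cases with
    | zero => simp only [Fin.cons_succ, Fin.cons_zero]; intro h; have := congrFun (congrFun h 1) 1; simp at this; exact ha.ne' this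
    | succ k'' =>
      simp only [Fin.cons_succ]; intro h; have := congrFun (congrFun h 1) 1; simp at this; exact (hAt k'').ne' this

/-- The exponents `0 | 1 | n > Dt 0 > Dt 1 > ⋯ ≥ 2` of the tilted design are pairwise distinct. [folklore] -/
theorem tilted_exponents_injective {G n : ℕ} {Dt : Fin (G + 1) → ℕ} (hn : ∀ k, Dt k < n) (hDt : StrictAnti Dt)
    (hDt2 : ∀ k, 2 ≤ Dt k) : Function.Injective (Fin.cons 0 (Fin.cons n Dt) : Fin (G + 1 + 1 + 1) → ℕ) := by
  refine Fin.cons_injective_iff.2 ⟨?_, Fin.cons_injective_iff.2 ⟨?_, hDt.injective⟩⟩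
  · rintro ⟨k, hk⟩
    cases k using Fin.cases with
    | zero => have := hn 0; simp at hk; omega
    | succ k' => have := hDt2 k'; simp at hk; omega
  · rintro ⟨k, hk⟩
    have := hn k
    exact absurd hk this.ne

/-- The upper letters of the tilted design sit strictly above the pivot exponent `1`. [folklore] -/
theorem tilted_exponents_above {G n : ℕ} {Dt : Fin (G + 1) → ℕ} (hn : ∀ k, Dt k < n) (hDt2 : ∀ k, 2 ≤ Dt k) :
    ∀ k : Fin (G + 1 + 1 + 1), k ≠ 0 → 1 < (Fin.cons 0 (Fin.cons n Dt) : Fin (G + 1 + 1 + 1) → ℕ) k := by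
  intro k hk
  cases k using Fin.cases with
  | zero => exact absurd rfl hk
  | succ k' =>
    cases k' using Fin.cases with
    | zero => have := hn 0; have := hDt2 0; simp only [Fin.cons_succ, Fin.cons_zero]; omega
    | succ k'' => have := hDt2 k''; simp only [Fin.cons_succ]; omega

/-! ## 2. Rank-one lone letter: the `(1 | K−1)` NSD row is EXACTLY `2K − 1` for every `K ≥ 3` -/

/-- **ALL-K FLOOR `2K − 1`, rank-one lone letter (`K ≥ 3`)** — matches gen 27's END-LAW ceiling. [folklore] -/
theorem twoK_sub_one_le_budget_loneBelow_rankOne {K B : ℕ} (hK : 3 ≤ K)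
    (h : ∀ (e : ℕ) (d : Fin K → ℕ) (J : Matrix (Fin 2) (Fin 2) ℝ) (P : Fin K → Matrix (Fin 2) (Fin 2) ℝ) (k₀ : Fin K),
        (-J).PosSemidef → (∀ k, (P k).PosSemidef) → d k₀ < e → (∀ k, k ≠ k₀ → e < d k) → (P k₀).det = 0 →
        pivotPosRoots e d J P ≤ B) : 2 * K - 1 ≤ B := by
  obtain ⟨G, rfl⟩ : ∃ G, K = G + 1 + 1 + 1 := ⟨K - 3, by omega⟩
  obtain ⟨n, Dt, a, At, ε, hn, hDt, hDt2, ha, hAt, _, hZ⟩ := exists_tilted_rankOne_design G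
  have hB := h 1 (Fin.cons 0 (Fin.cons n Dt) : Fin (G + 1 + 1 + 1) → ℕ) _
      (Fin.cons (!![(1 : ℝ), 1; 1, 1]) (Fin.cons (!![a * ε ^ 2, a * ε; a * ε, a]) (fun k => !![(0 : ℝ), 0; 0, At k]))
        : Fin (G + 1 + 1 + 1) → Matrix (Fin 2) (Fin 2) ℝ) 0
    neg_J_posSemidef (tilted_letters_posSemidef ha hAt le_rfl) (by simp)
    (tilted_exponents_above hn hDt2) (by simp [Matrix.det_fin_two])
  omega

/-- **GENUINE ALL-K FLOOR `2K − 1`, rank-one lone letter (`K ≥ 3`)** (non-zero letters, pairwise distinct exponents). [folklore] -/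
theorem twoK_sub_one_le_budget_genuine_loneBelow_rankOne {K B : ℕ} (hK : 3 ≤ K)
    (h : ∀ (e : ℕ) (d : Fin K → ℕ) (J : Matrix (Fin 2) (Fin 2) ℝ) (P : Fin K → Matrix (Fin 2) (Fin 2) ℝ) (k₀ : Fin K),
        (-J).PosSemidef → Function.Injective d → (∀ k, (P k).PosSemidef ∧ P k ≠ 0) → d k₀ < e → (∀ k, k ≠ k₀ → e < d k) →
        (P k₀).det = 0 → pivotPosRoots e d J P ≤ B) : 2 * K - 1 ≤ B := by
  obtain ⟨G, rfl⟩ : ∃ G, K = G + 1 + 1 + 1 := ⟨K - 3, by omega⟩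
  obtain ⟨n, Dt, a, At, ε, hn, hDt, hDt2, ha, hAt, _, hZ⟩ := exists_tilted_rankOne_design G
  have hB := h 1 (Fin.cons 0 (Fin.cons n Dt) : Fin (G + 1 + 1 + 1) → ℕ) _
      (Fin.cons (!![(1 : ℝ), 1; 1, 1]) (Fin.cons (!![a * ε ^ 2, a * ε; a * ε, a]) (fun k => !![(0 : ℝ), 0; 0, At k]))
        : Fin (G + 1 + 1 + 1) → Matrix (Fin 2) (Fin 2) ℝ) 0
    neg_J_posSemidef (tilted_exponents_injective hn hDt hDt2)
    (fun k => ⟨tilted_letters_posSemidef ha hAt le_rfl k, tilted_letters_ne_zero 1 ha hAt k⟩) (by simp)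
    (tilted_exponents_above hn hDt2) (by simp [Matrix.det_fin_two])
  omega

/-- **THE RANK-ONE-LONE `(1 | K−1)` NSD ROW IS EXACTLY `2K − 1` FOR EVERY `K ≥ 3`** (iff-with-budget form of gen 27's
`nsd_loneBelow_rankOne_three_iff`, now for all `K`): a budget `B` is valid for every `2 × 2` pivot pencil with `−J ⪰ 0` and `K`
PSD letters, exactly one of which — of rank `≤ 1` — lies strictly below the pivot exponent and all others strictly above, IFF
`2K − 1 ≤ B`.  THE END LAW IS SHARP FOR EVERY `K ≥ 3`; `K = 3, 4` recover the tree's `5`, `7`. [folklore] -/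
theorem loneBelow_rankOne_iff {K : ℕ} (hK : 3 ≤ K) (B : ℕ) :
    (∀ (e : ℕ) (d : Fin K → ℕ) (J : Matrix (Fin 2) (Fin 2) ℝ) (P : Fin K → Matrix (Fin 2) (Fin 2) ℝ) (k₀ : Fin K),
        (-J).PosSemidef → (∀ k, (P k).PosSemidef) → d k₀ < e → (∀ k, k ≠ k₀ → e < d k) → (P k₀).det = 0 →
        pivotPosRoots e d J P ≤ B) ↔ 2 * K - 1 ≤ B := by
  refine ⟨twoK_sub_one_le_budget_loneBelow_rankOne hK, fun hB e d J P k₀ hJ hP hbot hup hrk => ?_⟩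
  have h := NsdLoneRankOne.pivotPosRoots_succ_le_of_lone_below e d J P hJ hP k₀ hbot hup hrk
  omega

/-- **Genuine sub-class, same row: valid IFF `2K − 1 ≤ B`** (`K ≥ 3`). [folklore] -/
theorem loneBelow_rankOne_genuine_iff {K : ℕ} (hK : 3 ≤ K) (B : ℕ) :
    (∀ (e : ℕ) (d : Fin K → ℕ) (J : Matrix (Fin 2) (Fin 2) ℝ) (P : Fin K → Matrix (Fin 2) (Fin 2) ℝ) (k₀ : Fin K),
        (-J).PosSemidef → Function.Injective d → (∀ k, (P k).PosSemidef ∧ P k ≠ 0) → d k₀ < e → (∀ k, k ≠ k₀ → e < d k) →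
        (P k₀).det = 0 → pivotPosRoots e d J P ≤ B) ↔ 2 * K - 1 ≤ B := by
  refine ⟨twoK_sub_one_le_budget_genuine_loneBelow_rankOne hK, fun hB e d J P k₀ hJ _ hP hbot hup hrk => ?_⟩
  have h := NsdLoneRankOne.pivotPosRoots_succ_le_of_lone_below e d J P hJ (fun k => (hP k).1) k₀ hbot hup hrk
  omega

/-- **THE END LAW IS ATTAINED FOR EVERY `K ≥ 3`**: a rank-one-lone `(1 | K−1)` NSD pencil (genuine: pairwise distinct exponents,
non-zero rank-one letters) with EXACTLY `2K − 1` positive roots. [folklore] -/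
theorem exists_loneBelow_rankOne_eq {K : ℕ} (hK : 3 ≤ K) :
    ∃ (e : ℕ) (d : Fin K → ℕ) (J : Matrix (Fin 2) (Fin 2) ℝ) (P : Fin K → Matrix (Fin 2) (Fin 2) ℝ) (k₀ : Fin K),
      (-J).PosSemidef ∧ Function.Injective d ∧ (∀ k, (P k).PosSemidef ∧ P k ≠ 0) ∧ d k₀ < e ∧ (∀ k, k ≠ k₀ → e < d k) ∧
      (P k₀).det = 0 ∧ pivotPosRoots e d J P = 2 * K - 1 := by
  obtain ⟨G, rfl⟩ : ∃ G, K = G + 1 + 1 + 1 := ⟨K - 3, by omega⟩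
  obtain ⟨n, Dt, a, At, ε, hn, hDt, hDt2, ha, hAt, _, hZ⟩ := exists_tilted_rankOne_design G
  refine ⟨1, (Fin.cons 0 (Fin.cons n Dt) : Fin (G + 1 + 1 + 1) → ℕ),
      (!![(-1 : ℝ), 0; 0, -1] : Matrix (Fin 2) (Fin 2) ℝ),
      (Fin.cons (!![(1 : ℝ), 1; 1, 1]) (Fin.cons (!![a * ε ^ 2, a * ε; a * ε, a]) (fun k => !![(0 : ℝ), 0; 0, At k]))
        : Fin (G + 1 + 1 + 1) → Matrix (Fin 2) (Fin 2) ℝ), 0, neg_J_posSemidef, tilted_exponents_injective hn hDt hDt2,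
    fun k => ⟨tilted_letters_posSemidef ha hAt le_rfl k, tilted_letters_ne_zero 1 ha hAt k⟩, by simp,
    tilted_exponents_above hn hDt2, by simp [Matrix.det_fin_two], ?_⟩
  have h := NsdLoneRankOne.pivotPosRoots_succ_le_of_lone_below 1 (Fin.cons 0 (Fin.cons n Dt) : Fin (G + 1 + 1 + 1) → ℕ)
      (!![(-1 : ℝ), 0; 0, -1] : Matrix (Fin 2) (Fin 2) ℝ)
      (Fin.cons (!![(1 : ℝ), 1; 1, 1]) (Fin.cons (!![a * ε ^ 2, a * ε; a * ε, a]) (fun k => !![(0 : ℝ), 0; 0, At k]))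
        : Fin (G + 1 + 1 + 1) → Matrix (Fin 2) (Fin 2) ℝ) neg_J_posSemidef
    (tilted_letters_posSemidef ha hAt le_rfl) 0 (by simp) (tilted_exponents_above hn hDt2)
    (by simp [Matrix.det_fin_two])
  omega

/-! ## 3. Free lone letter: the `(1 | K−1)` NSD row is EXACTLY `2K` for every `K ≥ 3` -/

/-- **ALL-K FLOOR `2K`, free lone letter (`K ≥ 3`)** — matches the NSD `2K` law. [folklore] -/
theorem twoK_le_budget_loneBelow {K B : ℕ} (hK : 3 ≤ K)
    (h : ∀ (e : ℕ) (d : Fin K → ℕ) (J : Matrix (Fin 2) (Fin 2) ℝ) (P : Fin K → Matrix (Fin 2) (Fin 2) ℝ) (k₀ : Fin K),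
        (-J).PosSemidef → (∀ k, (P k).PosSemidef) → d k₀ < e → (∀ k, k ≠ k₀ → e < d k) →
        pivotPosRoots e d J P ≤ B) : 2 * K ≤ B := by
  obtain ⟨G, rfl⟩ : ∃ G, K = G + 1 + 1 + 1 := ⟨K - 3, by omega⟩
  obtain ⟨n, Dt, a, At, ε, δ, hn, hDt, hDt2, ha, hAt, _, hδ, hZ⟩ := exists_tilted_fullRank_design G
  have hB := h 1 (Fin.cons 0 (Fin.cons n Dt) : Fin (G + 1 + 1 + 1) → ℕ) _
      (Fin.cons (!![(1 : ℝ), 1; 1, 1 + δ]) (Fin.cons (!![a * ε ^ 2, a * ε; a * ε, a]) (fun k => !![(0 : ℝ), 0; 0, At k]))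
        : Fin (G + 1 + 1 + 1) → Matrix (Fin 2) (Fin 2) ℝ) 0
    neg_J_posSemidef (tilted_letters_posSemidef ha hAt (by linarith)) (by simp)
    (tilted_exponents_above hn hDt2)
  omega

/-- **GENUINE ALL-K FLOOR `2K`, free lone letter (`K ≥ 3`).** [folklore] -/
theorem twoK_le_budget_genuine_loneBelow {K B : ℕ} (hK : 3 ≤ K)
    (h : ∀ (e : ℕ) (d : Fin K → ℕ) (J : Matrix (Fin 2) (Fin 2) ℝ) (P : Fin K → Matrix (Fin 2) (Fin 2) ℝ) (k₀ : Fin K),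
        (-J).PosSemidef → Function.Injective d → (∀ k, (P k).PosSemidef ∧ P k ≠ 0) → d k₀ < e → (∀ k, k ≠ k₀ → e < d k) →
        pivotPosRoots e d J P ≤ B) : 2 * K ≤ B := by
  obtain ⟨G, rfl⟩ : ∃ G, K = G + 1 + 1 + 1 := ⟨K - 3, by omega⟩
  obtain ⟨n, Dt, a, At, ε, δ, hn, hDt, hDt2, ha, hAt, _, hδ, hZ⟩ := exists_tilted_fullRank_design G
  have hB := h 1 (Fin.cons 0 (Fin.cons n Dt) : Fin (G + 1 + 1 + 1) → ℕ) _
      (Fin.cons (!![(1 : ℝ), 1; 1, 1 + δ]) (Fin.cons (!![a * ε ^ 2, a * ε; a * ε, a]) (fun k => !![(0 : ℝ), 0; 0, At k]))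
        : Fin (G + 1 + 1 + 1) → Matrix (Fin 2) (Fin 2) ℝ) 0
    neg_J_posSemidef (tilted_exponents_injective hn hDt hDt2)
    (fun k => ⟨tilted_letters_posSemidef ha hAt (by linarith) k, tilted_letters_ne_zero _ ha hAt k⟩) (by simp)
    (tilted_exponents_above hn hDt2)
  omega

/-- **THE FREE-LONE `(1 | K−1)` NSD ROW IS EXACTLY `2K` FOR EVERY `K ≥ 3`**: a budget is valid for every `2 × 2` pivot pencil with
`−J ⪰ 0` and `K` PSD letters, exactly one of which (of any rank) lies strictly below the pivot exponent and all others strictly above,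
IFF `2K ≤ B` (the NSD `2K` law `DefinitePivot.pivotPosRoots_le_two_mul_of_det_nonneg` is attained on this support);
`K = 3, 4` recover the tree's `6`, `8`. [folklore] -/
theorem loneBelow_iff {K : ℕ} (hK : 3 ≤ K) (B : ℕ) :
    (∀ (e : ℕ) (d : Fin K → ℕ) (J : Matrix (Fin 2) (Fin 2) ℝ) (P : Fin K → Matrix (Fin 2) (Fin 2) ℝ) (k₀ : Fin K),
        (-J).PosSemidef → (∀ k, (P k).PosSemidef) → d k₀ < e → (∀ k, k ≠ k₀ → e < d k) →
        pivotPosRoots e d J P ≤ B) ↔ 2 * K ≤ B := by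
  refine ⟨twoK_le_budget_loneBelow hK, fun hB e d J P k₀ hJ hP _ _ => ?_⟩
  exact ((loneBelow_bracket_allK K).2 e d J P hJ hP).trans hB

/-- **Genuine sub-class, same row: valid IFF `2K ≤ B`** (`K ≥ 3`). [folklore] -/
theorem loneBelow_genuine_iff {K : ℕ} (hK : 3 ≤ K) (B : ℕ) :
    (∀ (e : ℕ) (d : Fin K → ℕ) (J : Matrix (Fin 2) (Fin 2) ℝ) (P : Fin K → Matrix (Fin 2) (Fin 2) ℝ) (k₀ : Fin K),
        (-J).PosSemidef → Function.Injective d → (∀ k, (P k).PosSemidef ∧ P k ≠ 0) → d k₀ < e → (∀ k, k ≠ k₀ → e < d k) →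
        pivotPosRoots e d J P ≤ B) ↔ 2 * K ≤ B := by
  refine ⟨twoK_le_budget_genuine_loneBelow hK, fun hB e d J P k₀ hJ _ hP _ _ => ?_⟩
  exact ((loneBelow_bracket_allK K).2 e d J P hJ fun k => (hP k).1).trans hB

/-- **THE NSD `2K` LAW IS ATTAINED ON `(1 | K−1)` FOR EVERY `K ≥ 3`**: a free-lone `(1 | K−1)` NSD pencil (genuine, lone letter of
full rank) with EXACTLY `2K` positive roots. [folklore] -/
theorem exists_loneBelow_eq {K : ℕ} (hK : 3 ≤ K) :
    ∃ (e : ℕ) (d : Fin K → ℕ) (J : Matrix (Fin 2) (Fin 2) ℝ) (P : Fin K → Matrix (Fin 2) (Fin 2) ℝ) (k₀ : Fin K),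
      (-J).PosSemidef ∧ Function.Injective d ∧ (∀ k, (P k).PosSemidef ∧ P k ≠ 0) ∧ d k₀ < e ∧ (∀ k, k ≠ k₀ → e < d k) ∧
      0 < (P k₀).det ∧ pivotPosRoots e d J P = 2 * K := by
  obtain ⟨G, rfl⟩ : ∃ G, K = G + 1 + 1 + 1 := ⟨K - 3, by omega⟩
  obtain ⟨n, Dt, a, At, ε, δ, hn, hDt, hDt2, ha, hAt, _, hδ, hZ⟩ := exists_tilted_fullRank_design G
  refine ⟨1, (Fin.cons 0 (Fin.cons n Dt) : Fin (G + 1 + 1 + 1) → ℕ),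
      (!![(-1 : ℝ), 0; 0, -1] : Matrix (Fin 2) (Fin 2) ℝ),
      (Fin.cons (!![(1 : ℝ), 1; 1, 1 + δ]) (Fin.cons (!![a * ε ^ 2, a * ε; a * ε, a]) (fun k => !![(0 : ℝ), 0; 0, At k]))
        : Fin (G + 1 + 1 + 1) → Matrix (Fin 2) (Fin 2) ℝ), 0, neg_J_posSemidef, tilted_exponents_injective hn hDt hDt2,
    fun k => ⟨tilted_letters_posSemidef ha hAt (by linarith) k, tilted_letters_ne_zero _ ha hAt k⟩, by simp,
    tilted_exponents_above hn hDt2, by simp [Matrix.det_fin_two]; linarith, ?_⟩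
  have h := (loneBelow_bracket_allK (G + 1 + 1 + 1)).2 1 (Fin.cons 0 (Fin.cons n Dt) : Fin (G + 1 + 1 + 1) → ℕ)
      (!![(-1 : ℝ), 0; 0, -1] : Matrix (Fin 2) (Fin 2) ℝ)
      (Fin.cons (!![(1 : ℝ), 1; 1, 1 + δ]) (Fin.cons (!![a * ε ^ 2, a * ε; a * ε, a]) (fun k => !![(0 : ℝ), 0; 0, At k]))
        : Fin (G + 1 + 1 + 1) → Matrix (Fin 2) (Fin 2) ℝ) neg_J_posSemidef
    (tilted_letters_posSemidef ha hAt (by linarith : (1 : ℝ) ≤ 1 + δ))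
  omega

/-! ## 4. `K = 5` (the question of record «7 or 9?»: NINE; free lone: TEN) -/

/-- **`K = 5`, rank-one lone letter: the `(1 | 4)` NSD row is EXACTLY `9`** (gens 27–28 located `7`). [folklore] -/
theorem loneBelow_rankOne_five_iff (B : ℕ) :
    (∀ (e : ℕ) (d : Fin 5 → ℕ) (J : Matrix (Fin 2) (Fin 2) ℝ) (P : Fin 5 → Matrix (Fin 2) (Fin 2) ℝ) (k₀ : Fin 5),
        (-J).PosSemidef → (∀ k, (P k).PosSemidef) → d k₀ < e → (∀ k, k ≠ k₀ → e < d k) → (P k₀).det = 0 →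
        pivotPosRoots e d J P ≤ B) ↔ 9 ≤ B :=
  loneBelow_rankOne_iff (K := 5) (by norm_num) B

/-- **`K = 5`, free lone letter: the `(1 | 4)` NSD row is EXACTLY `10`** (located `8` before). [folklore] -/
theorem loneBelow_five_iff (B : ℕ) :
    (∀ (e : ℕ) (d : Fin 5 → ℕ) (J : Matrix (Fin 2) (Fin 2) ℝ) (P : Fin 5 → Matrix (Fin 2) (Fin 2) ℝ) (k₀ : Fin 5),
        (-J).PosSemidef → (∀ k, (P k).PosSemidef) → d k₀ < e → (∀ k, k ≠ k₀ → e < d k) →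
        pivotPosRoots e d J P ≤ B) ↔ 10 ≤ B :=
  loneBelow_iff (K := 5) (by norm_num) B

/-! ## 5. The small formats `K = 1, 2` (fewer than two upper letters: no tilt needed) and the rows for EVERY `K ≥ 1` -/

/-- `K = 1`: `det(−t·1 + !![1,1;1,c]) = (1 − t)(c − t) − 1`. [folklore] -/
theorem eval_det_single (c t : ℝ) :
    (t ^ 1 • (!![(-1 : ℝ), 0; 0, -1] : Matrix (Fin 2) (Fin 2) ℝ)
      + ∑ k, t ^ (![0] : Fin 1 → ℕ) k • ((![!![(1 : ℝ), 1; 1, c]] : Fin 1 → Matrix (Fin 2) (Fin 2) ℝ) k)).det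
      = (1 - t) * (c - t) - 1 := by
  rw [Matrix.det_fin_two]
  simp [Matrix.add_apply]
  ring

/-- `K = 2`: `det(−t·1 + !![1,1;1,c] + tⁿ diag(A, B)) = (1 − t + A tⁿ)(c − t + B tⁿ) − 1`. [folklore] -/
theorem eval_det_pair (A B c : ℝ) (n : ℕ) (t : ℝ) :
    (t ^ 1 • (!![(-1 : ℝ), 0; 0, -1] : Matrix (Fin 2) (Fin 2) ℝ)
      + ∑ k, t ^ (![0, n] : Fin 2 → ℕ) k •
        ((![!![(1 : ℝ), 1; 1, c], !![A, 0; 0, B]] : Fin 2 → Matrix (Fin 2) (Fin 2) ℝ) k)).det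
      = (1 - t + A * t ^ n) * (c - t + B * t ^ n) - 1 := by
  rw [Matrix.det_fin_two]
  simp [Matrix.add_apply, Fin.sum_univ_two]
  ring

/-- **`K = 1`**: the lone rank-one letter alone gives `1 = 2K − 1` root (`t = 2`); with the full-rank lone letter `!![1,1;1,2]`,
`2 = 2K` roots (`t² − 3t + 1`). [folklore] -/
theorem small_one :
    1 ≤ pivotPosRoots 1 (![0] : Fin 1 → ℕ) (!![(-1 : ℝ), 0; 0, -1] : Matrix (Fin 2) (Fin 2) ℝ)
        ((![!![(1 : ℝ), 1; 1, 1]] : Fin 1 → Matrix (Fin 2) (Fin 2) ℝ)) ∧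
    2 ≤ pivotPosRoots 1 (![0] : Fin 1 → ℕ) (!![(-1 : ℝ), 0; 0, -1] : Matrix (Fin 2) (Fin 2) ℝ)
        ((![!![(1 : ℝ), 1; 1, 2]] : Fin 1 → Matrix (Fin 2) (Fin 2) ℝ)) := by
  constructor
  · exact le_pivotPosRoots_of_certificate (N := 1) (eval_det_single 1) ![1, 3]
      (by refine Fin.strictMono_iff_lt_succ.2 fun j => ?_; fin_cases j; simp only [Fin.castSucc_mk, Fin.succ_mk]; norm_num)
      (by intro j; fin_cases j <;> norm_num)
      (by intro j; fin_cases j; simp only [Fin.castSucc_mk, Fin.succ_mk]; norm_num)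
  · exact le_pivotPosRoots_of_certificate (N := 2) (eval_det_single 2) ![1 / 4, 1, 3]
      (by refine Fin.strictMono_iff_lt_succ.2 fun j => ?_; fin_cases j <;> simp only [Fin.castSucc_mk, Fin.succ_mk] <;> norm_num)
      (by intro j; fin_cases j <;> norm_num)
      (by intro j; fin_cases j <;> simp only [Fin.castSucc_mk, Fin.succ_mk] <;> norm_num)

/-- **`K = 2`**: lone rank-one letter plus ONE full-rank upper letter `diag(100, 1/1000) t²` gives `3 = 2K − 1` roots (signs at
`10⁻³, 1/4, 1, 2000`); with the full-rank lone letter `!![1,1;1,1+10⁻⁴]`, `4 = 2K` roots (one more sign near `0`). [folklore] -/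
theorem small_two :
    3 ≤ pivotPosRoots 1 (![0, 2] : Fin 2 → ℕ) (!![(-1 : ℝ), 0; 0, -1] : Matrix (Fin 2) (Fin 2) ℝ)
        ((![!![(1 : ℝ), 1; 1, 1], !![100, 0; 0, 1 / 1000]] : Fin 2 → Matrix (Fin 2) (Fin 2) ℝ)) ∧
    4 ≤ pivotPosRoots 1 (![0, 2] : Fin 2 → ℕ) (!![(-1 : ℝ), 0; 0, -1] : Matrix (Fin 2) (Fin 2) ℝ)
        ((![!![(1 : ℝ), 1; 1, 1 + 1 / 10000], !![100, 0; 0, 1 / 1000]] : Fin 2 → Matrix (Fin 2) (Fin 2) ℝ)) := by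
  constructor
  · exact le_pivotPosRoots_of_certificate (N := 3) (eval_det_pair 100 (1 / 1000) 1 2) ![1 / 1000, 1 / 4, 1, 2000]
      (by refine Fin.strictMono_iff_lt_succ.2 fun j => ?_; fin_cases j <;> simp only [Fin.castSucc_mk, Fin.succ_mk] <;> norm_num)
      (by intro j; fin_cases j <;> norm_num)
      (by intro j; fin_cases j <;> simp only [Fin.castSucc_mk, Fin.succ_mk] <;> norm_num)
  · exact le_pivotPosRoots_of_certificate (N := 4) (eval_det_pair 100 (1 / 1000) (1 + 1 / 10000) 2)
      ![1 / 1000000, 1 / 1000, 1 / 4, 1, 2000]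
      (by refine Fin.strictMono_iff_lt_succ.2 fun j => ?_; fin_cases j <;> simp only [Fin.castSucc_mk, Fin.succ_mk] <;> norm_num)
      (by intro j; fin_cases j <;> norm_num)
      (by intro j; fin_cases j <;> simp only [Fin.castSucc_mk, Fin.succ_mk] <;> norm_num)

/-- The small designs lie in the classes (PSD letters). [folklore] -/
theorem small_letters_posSemidef (c : ℝ) (hc : 1 ≤ c) :
    ((!![(1 : ℝ), 1; 1, c] : Matrix (Fin 2) (Fin 2) ℝ)).PosSemidef ∧
    ((!![(100 : ℝ), 0; 0, 1 / 1000] : Matrix (Fin 2) (Fin 2) ℝ)).PosSemidef :=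
  ⟨PivotTwoFourWitness.posSemidef_two_of_entries 1 1 c (by norm_num) (by linarith) (by linarith),
    PivotTwoFourWitness.posSemidef_two_of_entries 100 0 (1 / 1000) (by norm_num) (by norm_num) (by norm_num)⟩

/-- **THE RANK-ONE-LONE `(1 | K−1)` NSD ROW IS EXACTLY `2K − 1` FOR EVERY `K ≥ 1`: THE END LAW IS SHARP AT EVERY `K`.** [folklore] -/
theorem loneBelow_rankOne_iff_allK {K : ℕ} (hK : 1 ≤ K) (B : ℕ) :
    (∀ (e : ℕ) (d : Fin K → ℕ) (J : Matrix (Fin 2) (Fin 2) ℝ) (P : Fin K → Matrix (Fin 2) (Fin 2) ℝ) (k₀ : Fin K),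
        (-J).PosSemidef → (∀ k, (P k).PosSemidef) → d k₀ < e → (∀ k, k ≠ k₀ → e < d k) → (P k₀).det = 0 →
        pivotPosRoots e d J P ≤ B) ↔ 2 * K - 1 ≤ B := by
  rcases Nat.lt_or_ge K 3 with hK3 | hK3
  · refine ⟨fun h => ?_, fun hB e d J P k₀ hJ hP hbot hup hrk => ?_⟩
    · interval_cases K
      · have h1 := h 1 ![0] _ ![!![(1 : ℝ), 1; 1, 1]] 0 neg_J_posSemidef
          (fun k => by fin_cases k; simpa using (small_letters_posSemidef 1 le_rfl).1) (by simp)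
          (fun k hk => by fin_cases k; exact absurd rfl hk) (by simp [Matrix.det_fin_two])
        have := small_one.1
        omega
      · have h2 := h 1 ![0, 2] _ ![!![(1 : ℝ), 1; 1, 1], !![100, 0; 0, 1 / 1000]] 0 neg_J_posSemidef
          (fun k => by
            fin_cases k
            · simpa using (small_letters_posSemidef 1 le_rfl).1
            · simpa using (small_letters_posSemidef 1 le_rfl).2)
          (by simp) (fun k hk => by fin_cases k <;> simp_all) (by simp [Matrix.det_fin_two])
        have := small_two.1
        omega
    · have h := NsdLoneRankOne.pivotPosRoots_succ_le_of_lone_below e d J P hJ hP k₀ hbot hup hrk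
      omega
  · exact loneBelow_rankOne_iff hK3 B

/-- **THE FREE-LONE `(1 | K−1)` NSD ROW IS EXACTLY `2K` FOR EVERY `K ≥ 1`: THE NSD `2K` LAW IS SHARP ON `(1 | K−1)` AT EVERY `K`.**
[folklore] -/
theorem loneBelow_iff_allK {K : ℕ} (hK : 1 ≤ K) (B : ℕ) :
    (∀ (e : ℕ) (d : Fin K → ℕ) (J : Matrix (Fin 2) (Fin 2) ℝ) (P : Fin K → Matrix (Fin 2) (Fin 2) ℝ) (k₀ : Fin K),
        (-J).PosSemidef → (∀ k, (P k).PosSemidef) → d k₀ < e → (∀ k, k ≠ k₀ → e < d k) →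
        pivotPosRoots e d J P ≤ B) ↔ 2 * K ≤ B := by
  rcases Nat.lt_or_ge K 3 with hK3 | hK3
  · refine ⟨fun h => ?_, fun hB e d J P k₀ hJ hP _ _ => ((loneBelow_bracket_allK K).2 e d J P hJ hP).trans hB⟩
    interval_cases K
    · have h1 := h 1 ![0] _ ![!![(1 : ℝ), 1; 1, 2]] 0 neg_J_posSemidef
        (fun k => by fin_cases k; simpa using (small_letters_posSemidef 2 (by norm_num)).1) (by simp)
        (fun k hk => by fin_cases k; exact absurd rfl hk)
      have := small_one.2
      omega
    · have h2 := h 1 ![0, 2] _ ![!![(1 : ℝ), 1; 1, 1 + 1 / 10000], !![100, 0; 0, 1 / 1000]] 0 neg_J_posSemidef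
        (fun k => by
          fin_cases k
          · simpa using (small_letters_posSemidef (1 + 1 / 10000) (by norm_num)).1
          · simpa using (small_letters_posSemidef (1 + 1 / 10000) (by norm_num)).2)
        (by simp) (fun k hk => by fin_cases k <;> simp_all)
      have := small_two.2
      omega
  · exact loneBelow_iff hK3 B

/-- **THE WHOLE `2 × 2` NSD-PIVOT ROW IS EXACTLY `2K` FOR EVERY `K ≥ 1`** (gen 11's question «NSD pivot column at n = 2: K-free law
refuted; `2K` sharp for `K = 2, 3, 4`» — now every `K`): a budget is valid for every `2 × 2` pivot pencil with `−J ⪰ 0` and `K` PSD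
letters (no support or rank restriction) IFF `2K ≤ B`. [folklore] -/
theorem nsd_two_iff_allK {K : ℕ} (hK : 1 ≤ K) (B : ℕ) :
    (∀ (e : ℕ) (d : Fin K → ℕ) (J : Matrix (Fin 2) (Fin 2) ℝ) (P : Fin K → Matrix (Fin 2) (Fin 2) ℝ),
        (-J).PosSemidef → (∀ k, (P k).PosSemidef) → pivotPosRoots e d J P ≤ B) ↔ 2 * K ≤ B :=
  ⟨fun h => (loneBelow_iff_allK hK B).1 fun e d J P _ hJ hP _ _ => h e d J P hJ hP,
    fun hB e d J P hJ hP => ((loneBelow_bracket_allK K).2 e d J P hJ hP).trans hB⟩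

end Summit.ValiantsHypothesis.ValiantsHypothesis.Theorems.LacunarySymmetroidMatrixDescartes.Pivot.NsdLoneTiltedRows
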